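import Summits.Ventures.GridStability.Models.IEEE118SP
import Summits.Ventures.GridStability.Lyapunov.StructurePreservingLevelBound
import Summits.Ventures.GridStability.Lyapunov.StructurePreservingRoa
import HarnessLib

/-!
# GridStability/Bench/IEEE118SPEnergyRoa — «G2-SCALE IEEE118-SP172 energy-route region of attraction (CS18α SIZE INSTRUMENT — printed network + declared-synthetic machine layer (MODELLED), no verdict)»: the certified energy-route region of attraction of the
# 172-node STRUCTURE-PRESERVING instance `Models/IEEE118SP.lean`, with the RATIONAL level `c = 61/100`

LADDER-GRIDFUSION G2-SCALE experiment cell (DIRECTOR RULING 70/71; lead g19 §0 v1 (1/3) Q1(α) «(α) ENERGY shape = ONE instantiation of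
`Lyapunov.StructurePreservingRoa.sublevel_subset_regionOfAttraction` with a rational level c below a certified lower bound of
`levelBound θ β` (`levelBound_two_mul_arctan_ge_pi`), assembly on the template `Bench/NE39SPEnergyRoa.lean` (p481288)»). GENERATED by
`cert/sos-2/sp/gen_sp_bench_lean.py` (gridfusion-sos-2) from the instance file `sp172.json` (sha16 `dca6c838864bcb9d`) — decls and
proofs VERBATIM the template; no literal typed by hand. INPUTS: `Models/IEEE118SP.lean` (every hypothesis of the theorem of record discharged for the
data + `roa_of_lt_levelBound` = the certificate MODULO the level), `Lyapunov/StructurePreservingRoa.lean` (p475989), `…LevelBound.lean` (p479424).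

THREE COLUMNS. CERTIFIED (kernel, here): `61/100 < c⋆(θ, β) = (1 − sin θ)·β·(π/2 − θ)/4` for `θ = 2·arctan τ_max`, `τ_max = 20562859009/180340167487`,
`β = 244032/102875` (column LF), by `levelBound_two_mul_arctan_ge_pi` (`arctan τ ≤ τ`, `3.141592 < π`): the rational bound evaluates to
`≈ 0.6170` (float `c⋆ ≈ 0.6175`; `61/100` is 98.9 % of it) — `level_lt_levelBound`; and the two sentences below
(`roa`, `tendsto_of_isSolution`). MODELLED = the tokens of `Models/IEEE118SP.lean` (structure-preserving classical machines, lossless, constant voltage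
magnitudes, frequency-dependent loads with UNPRINTED coefficients `Dᵢ > 0` — every statement holds for ALL such `D`); network: MATPOWER 7.1 `case118.m` AS DISTRIBUTED (paper:matpower71-case118, R2-signed W-R2-1; lossless, taps kept, PRINT INCONSISTENCIES #1/#2 recorded, no substitution) + DECLARED-SYNTHETIC machine layer x′_d 0.25 pu / H 4 s on the rating proxy (MODELLED; the case prints no dynamic data, acq-14091 open) — SIZE INSTRUMENT (dag-1 row CS18α, layer A), no verdict. VALIDATED: not here.
No sentence of this file says that a grid is stable. No definition, no named fact; standard axioms.
-/

noncomputable section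

open Set Filter Topology Real
open Summit.Ventures.GridStability.Models
open Summit.Ventures.GridStability.Models.StructurePreserving
open Summit.Ventures.GridStability.Models.IEEE118SP

namespace Summit.Ventures.GridStability.Bench.IEEE118SP

/-- **The certified level (kernel inequality): `61/100 < c⋆(θ, β)`** for the IEEE118SP data
(`θ = 2·arctan(20562859009/180340167487)`, `β = 244032/102875`), from the rational lower bound
`β·((1 − τ)²/(1 + τ²))·(1570796/10⁶ − 2τ)/4 ≈ 0.6170` of `levelBound_two_mul_arctan_ge_pi`.
CERTIFIED column. [folklore] -/
theorem level_lt_levelBound :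
    (61 / 100 : ℝ) < Lyapunov.StructurePreserving.levelBound IEEE118SP.θ (IEEE118SP.betaLF : ℝ) := by
  have hτ0 : (0 : ℝ) ≤ (IEEE118SP.tauLF : ℝ) := by
    exact_mod_cast (show (0 : ℚ) ≤ IEEE118SP.tauLF by norm_num [IEEE118SP.tauLF])
  have hτ1 : (IEEE118SP.tauLF : ℝ) < 1 := by
    exact_mod_cast (show IEEE118SP.tauLF < 1 by norm_num [IEEE118SP.tauLF])
  have hβ : (0 : ℝ) ≤ (IEEE118SP.betaLF : ℝ) := by
    exact_mod_cast (show (0 : ℚ) ≤ IEEE118SP.betaLF by norm_num [IEEE118SP.betaLF])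
  have h := Lyapunov.StructurePreserving.levelBound_two_mul_arctan_ge_pi hτ0 hτ1 hβ
  have hq : (61 / 100 : ℚ) < IEEE118SP.betaLF * ((1 - IEEE118SP.tauLF) ^ 2 / (1 + IEEE118SP.tauLF ^ 2))
      * (1570796 / 1000000 - 2 * IEEE118SP.tauLF) / 4 := by
    norm_num [IEEE118SP.tauLF, IEEE118SP.betaLF]
  have hr : (61 / 100 : ℝ) < (IEEE118SP.betaLF : ℝ) * ((1 - (IEEE118SP.tauLF : ℝ)) ^ 2
      / (1 + (IEEE118SP.tauLF : ℝ) ^ 2)) * (1570796 / 1000000 - 2 * (IEEE118SP.tauLF : ℝ)) / 4 := by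
    have h' := (Rat.cast_lt (K := ℝ)).2 hq
    push_cast at h'
    exact h'
  unfold IEEE118SP.θ
  exact hr.trans_le h

/-- **«G2-SCALE IEEE118-SP172 energy-route region of attraction (CS18α SIZE INSTRUMENT — printed network + declared-synthetic machine layer (MODELLED), no verdict)» — the certified region of attraction (phase-space form).** MODEL M′ of `Models/IEEE118SP.lean`
(column LF), for EVERY damping / load-frequency vector `D > 0`: from every phase point `y = (δ, ω)` with every coupled branch
inside `|δᵢ − δⱼ| < π/2`, on the momentum level set through the equilibrium with zero bus pseudo-frequencies, and with energy
`V(δ₀; δ, ω) ≤ 61/100`, a global solution of the structure-preserving field exists, and EVERY global solution from `y` keeps the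
window, the constraint set and `V ≤ 61/100` for all `t ≥ 0` and tends to `(δ₀, 0)`. One call of `IEEE118SP.roa_of_lt_levelBound` at the
certified level `level_lt_levelBound`. MODEL M′ network of record — network: MATPOWER 7.1 `case118.m` AS DISTRIBUTED (paper:matpower71-case118, R2-signed W-R2-1; lossless, taps kept, PRINT INCONSISTENCIES #1/#2 recorded, no substitution) + DECLARED-SYNTHETIC machine layer x′_d 0.25 pu / H 4 s on the rating proxy (MODELLED; the case prints no dynamic data, acq-14091 open) — SIZE INSTRUMENT (dag-1 row CS18α, layer A), no verdict. No sentence here says a grid is stable. [folklore] -/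
theorem roa {D : Fin 172 → ℝ} (hD : ∀ i, 0 < D i) {y : (Fin 172 → ℝ) × (Fin 172 → ℝ)}
    (hy : y ∈ (params D).window ∩ (params D).constraintSet δ₀ ∧
      (params D).energy δ₀ y.1 y.2 ≤ 61 / 100) :
    (∃ X : ℝ → (Fin 172 → ℝ) × (Fin 172 → ℝ), X 0 = y ∧
      ∀ T : ℝ, ∀ s ∈ Icc 0 T,
        HasDerivWithinAt X ((params D).shifted.phaseField (X s)) (Icc 0 T) s) ∧
    ∀ X : ℝ → (Fin 172 → ℝ) × (Fin 172 → ℝ), X 0 = y →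
      (∀ T : ℝ, ∀ s ∈ Icc 0 T,
        HasDerivWithinAt X ((params D).shifted.phaseField (X s)) (Icc 0 T) s) →
      (∀ s, 0 ≤ s → X s ∈ (params D).window ∩ (params D).constraintSet δ₀ ∧
        (params D).energy δ₀ (X s).1 (X s).2 ≤ 61 / 100) ∧ Tendsto X atTop (𝓝 (δ₀, 0)) :=
  IEEE118SP.roa_of_lt_levelBound hD
    (by
      have h := level_lt_levelBound
      unfold Lyapunov.StructurePreserving.levelBound at h
      exact h) hy

/-- **«G2-SCALE IEEE118-SP172 energy-route region of attraction (CS18α SIZE INSTRUMENT — printed network + declared-synthetic machine layer (MODELLED), no verdict)» in the printed second-order vocabulary**: for EVERY `D > 0` and every solution `δ` of the structure-preserving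
model `params D` AS TYPED (`Params.IsSolution`; `ω₀ = Σ P⁰/Σ D = 0` because `P⁰ := f(δ₀)`) whose initial state has every coupled branch
inside `|δᵢ(0) − δⱼ(0)| < π/2`, momentum `L(δ(0), δ̇(0)) = L(δ₀, 0)` and energy `V(δ₀; δ(0), δ̇(0)) ≤ 61/100`: the window and `V ≤ 61/100`
hold for all `t ≥ 0`, every node angle converges, `δᵢ(t) → δ₀ᵢ`, and every generator frequency deviation tends to zero. MODEL M′ MODEL M′ network of record — network: MATPOWER 7.1 `case118.m` AS DISTRIBUTED (paper:matpower71-case118, R2-signed W-R2-1; lossless, taps kept, PRINT INCONSISTENCIES #1/#2 recorded, no substitution) + DECLARED-SYNTHETIC machine layer x′_d 0.25 pu / H 4 s on the rating proxy (MODELLED; the case prints no dynamic data, acq-14091 open) — SIZE INSTRUMENT (dag-1 row CS18α, layer A), no verdict.; no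
sentence here says a grid is stable. [cite: BergenHill1981] -/
theorem tendsto_of_isSolution {D : Fin 172 → ℝ} (hD : ∀ i, 0 < D i) {δ : ℝ → Fin 172 → ℝ}
    (hδ : (params D).IsSolution δ)
    (hwin : ∀ i j, (params D).b i j ≠ 0 → |δ 0 i - δ 0 j| < π / 2)
    (hL : (params D).momentum (δ 0) (fun i => deriv (fun u => δ u i) 0)
      = (params D).momentum δ₀ 0)
    (hV : (params D).energy δ₀ (δ 0) (fun i => deriv (fun u => δ u i) 0) ≤ 61 / 100) :
    (∀ t, 0 ≤ t → (∀ i j, (params D).b i j ≠ 0 → |δ t i - δ t j| < π / 2) ∧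
        (params D).energy δ₀ (δ t) (fun i => deriv (fun u => δ u i) t) ≤ 61 / 100) ∧
      Tendsto δ atTop (𝓝 δ₀) ∧
      ∀ i ∈ (params D).gen, Tendsto (fun t => deriv (fun u => δ u i) t) atTop (𝓝 0) := by
  have hs : (params D).shifted.IsSolution δ := by
    rw [(params D).shifted_eq_self_of_P0_eq_pe IEEE118SP.b_symm (IEEE118SP.params_P0 D)]
    exact hδ
  exact Lyapunov.StructurePreserving.tendsto_of_isSolution (wellFormed hD) (by decide)
    (preconnected D) (fun i j => by rw [params_b]; exact b_nonneg i j) beta_pos (edge_lower D)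
    theta_nonneg theta_lt_pi_div_two (window D) (isSyncEquilibrium D) level_lt_levelBound hs
    hwin hL hV

end Summit.Ventures.GridStability.Bench.IEEE118SP

end
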